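import Mathlib
import Literature.AlgebraicGeometry.HyperbolicPolynomials.HyperbolicityCone
import Literature.AlgebraicGeometry.HyperbolicPolynomials.SmoothBoundary
import Summits.ValiantsHypothesis.ValiantsHypothesis.Theorems.PermanentalConesPermanentalConeHardSlackAsPermanent
import Summits.ValiantsHypothesis.ValiantsHypothesis.Theorems.PermanentalConesPermanentalConeHardPsdRankTools

/-!
# `PermanentalConeHard` (stmt-ValiantsHypothesis-8654), line `birth` — level `c = 0` of the core stub

Route `PermanentalCones` of `ValiantsHypothesis`, crux `PermanentalConeHard` (H+), core stub
`stub_permanentalGradientPsdRank`: a nonnegative permanental family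
`Q_n = per[(Y_n)_{rows<r n}; x^{(n-r n)}]` with `Q_n(𝟙) > 0` whose gradient slack matrices
`S[i,k] = gradForm Q_n (z_k) (x_i) = ⟨∇Q_n(z_k), x_i⟩` (cone points `x_i, z_k ∈ Λ₊(Q_n, 𝟙)`) have
psd-rank exceeding every `m ≤ 2^((log₂ n + c)^c)`.  This file settles its LEVEL `c = 0`
(`stub_coreLevelZero`), where the bound is `2^((log₂ n + 0)^0) = 2`: some `n` must carry a gradient
slack matrix of psd-rank `≥ 3`.

Witness: `r := 0`, `Y := 0` (all rows variable), so `Q_n = per[x^{(n)}] = n! · x₁ ⋯ xₙ`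
(`LevelZero.rowPermanent_eq`); `Q_n(𝟙) = n! > 0`; every entrywise nonnegative point lies in
`Λ₊(Q_n, 𝟙)` (`LevelZero.mem_hyperbolicityCone_C_mul_prod_X`).  At `n = 3` take the standard basis
vectors `x_a = e_a` and the points `z_b = 𝟙 - e_b`: the slack matrix is
`⟨∇Q_3(𝟙 - e_b), e_a⟩ = 6 · ∏_{i ≠ a} (𝟙 - e_b)_i = 6 · [a = b]`
(`LevelZero.gradForm_C_mul_prod_X_single_indicator`), a `3 × 3` diagonal matrix with nonzero
diagonal, hence of psd-rank `≥ 3 > m` by the triangular (fooling-set) bound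
`stub_psdRankTriangularBound` of the psd-rank toolkit.

References: Fawzi–Gouveia–Parrilo–Robinson–Thomas, *Positive semidefinite rank*, Math. Program.
153 (2015) §2; everything here is elementary and proved in full.
-/

set_option linter.dupNamespace false

noncomputable section

namespace Summit.ValiantsHypothesis.ValiantsHypothesis.Theorems.PermanentalConesPermanentalConeHard

open MvPolynomial Finset
open scoped BigOperators
open Literature.AlgebraicGeometry.HyperbolicPolynomials

namespace LevelZero

/-- **The level-zero family.** With no constant rows, the permanental polynomial is
`per[x^{(n)}] = n! · x₁ ⋯ xₙ`. [folklore] -/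
theorem rowPermanent_eq (n : ℕ) (Y : Matrix (Fin n) (Fin n) ℝ) :
    (Matrix.of fun i j : Fin n =>
        if (i : ℕ) < 0 then C (Y i j) else (X j : MvPolynomial (Fin n) ℝ)).permanent =
      C ((Nat.factorial n : ℕ) : ℝ) * ∏ i : Fin n, X i := by
  have hmat : (Matrix.of fun i j : Fin n =>
      if (i : ℕ) < 0 then C (Y i j) else (X j : MvPolynomial (Fin n) ℝ)) =
      Matrix.of fun _ j : Fin n => (X j : MvPolynomial (Fin n) ℝ) := by
    ext i j
    rw [Matrix.of_apply, Matrix.of_apply, if_neg (Nat.not_lt_zero _)]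
  rw [hmat]
  unfold Matrix.permanent
  simp only [Matrix.of_apply]
  rw [Finset.sum_const, Finset.card_univ, Fintype.card_perm, Fintype.card_fin, nsmul_eq_mul,
    map_natCast]

/-- Evaluation of `c · x₁ ⋯ xₙ`. [folklore] -/
theorem eval_C_mul_prod_X {n : ℕ} (c : ℝ) (z : Fin n → ℝ) :
    MvPolynomial.eval z (C c * ∏ i : Fin n, (X i : MvPolynomial (Fin n) ℝ)) = c * ∏ i, z i := by
  simp only [map_mul, eval_C, map_prod, eval_X]

/-- `∂_a (x₁ ⋯ xₙ)` evaluated at `z` is `∏_{i ≠ a} z_i`. [folklore] -/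
theorem eval_pderiv_prod_X {n : ℕ} (a : Fin n) (z : Fin n → ℝ) :
    MvPolynomial.eval z (pderiv a (∏ i : Fin n, (X i : MvPolynomial (Fin n) ℝ))) =
      ∏ i ∈ Finset.univ.erase a, z i := by
  have hsplit : (∏ i : Fin n, (X i : MvPolynomial (Fin n) ℝ)) =
      X a * ∏ i ∈ Finset.univ.erase a, (X i : MvPolynomial (Fin n) ℝ) :=
    (Finset.mul_prod_erase _ _ (Finset.mem_univ a)).symm
  have h0 : pderiv a (∏ i ∈ Finset.univ.erase a, (X i : MvPolynomial (Fin n) ℝ)) = 0 := by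
    refine Finset.prod_induction _ (fun f => pderiv a f = 0) (fun f g hf hg => ?_) pderiv_one
      (fun i hi => pderiv_X_of_ne (Finset.ne_of_mem_erase hi))
    rw [pderiv_mul, hf, hg, zero_mul, mul_zero, add_zero]
  rw [hsplit, pderiv_mul, pderiv_X_self, one_mul, h0, mul_zero, add_zero, map_prod]
  exact Finset.prod_congr rfl fun i _ => eval_X _

/-- **Gradient slack entries of `c · x₁ ⋯ xₙ` against a basis vector**:
`⟨∇(c · x₁ ⋯ xₙ)(z), e_a⟩ = c · ∏_{i ≠ a} z_i`. [folklore] -/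
theorem gradForm_C_mul_prod_X_single {n : ℕ} (c : ℝ) (z : Fin n → ℝ) (a : Fin n) :
    gradForm (C c * ∏ i : Fin n, (X i : MvPolynomial (Fin n) ℝ)) z (Pi.single a 1) =
      c * ∏ i ∈ Finset.univ.erase a, z i := by
  have hL : gradForm (C c * ∏ i : Fin n, (X i : MvPolynomial (Fin n) ℝ)) z (Pi.single a 1) =
      ∑ j, (Pi.single a (1 : ℝ) : Fin n → ℝ) j *
        MvPolynomial.eval z (pderiv j (C c * ∏ i : Fin n, (X i : MvPolynomial (Fin n) ℝ))) :=
    rfl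
  rw [hL, Fintype.sum_eq_single a]
  · rw [Pi.single_eq_same, one_mul, pderiv_C_mul, map_mul, eval_C, eval_pderiv_prod_X]
  · intro j hj
    rw [Pi.single_eq_of_ne hj, zero_mul]

/-- **The level-zero slack matrix is diagonal**: against the basis vectors `e_a` and the points
`𝟙 - e_b`, `⟨∇(c · x₁ ⋯ xₙ)(𝟙 - e_b), e_a⟩ = c · [a = b]`. [folklore] -/
theorem gradForm_C_mul_prod_X_single_indicator {n : ℕ} (c : ℝ) (a b : Fin n) :
    gradForm (C c * ∏ i : Fin n, (X i : MvPolynomial (Fin n) ℝ))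
        (fun j => if j = b then 0 else 1) (Pi.single a 1) =
      if a = b then c else 0 := by
  rw [gradForm_C_mul_prod_X_single]
  split_ifs with hab
  · rw [Finset.prod_eq_one fun i hi => ?_, mul_one]
    exact if_neg fun hib => Finset.ne_of_mem_erase hi (hib.trans hab.symm)
  · rw [Finset.prod_eq_zero (i := b)
      (Finset.mem_erase.mpr ⟨fun h => hab h.symm, Finset.mem_univ b⟩), mul_zero]
    exact if_pos rfl

/-- **The nonnegative orthant lies in the cone of `c · x₁ ⋯ xₙ`** (`c > 0`): for `x ≥ 0`,
`c · ∏ (x_i + τ) > 0` for every `τ > 0`. [folklore] -/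
theorem mem_hyperbolicityCone_C_mul_prod_X {n : ℕ} {c : ℝ} (hc : 0 < c) {x : Fin n → ℝ}
    (hx : ∀ j, 0 ≤ x j) :
    x ∈ hyperbolicityCone (C c * ∏ i : Fin n, (X i : MvPolynomial (Fin n) ℝ))
      (fun _ => (1 : ℝ)) := by
  rw [mem_hyperbolicityCone_iff]
  intro τ hτ
  rw [eval_C_mul_prod_X]
  refine (mul_pos hc (Finset.prod_pos fun i _ => ?_)).ne'
  rw [Pi.add_apply, Pi.smul_apply, smul_eq_mul, mul_one]
  linarith [hx i]

end LevelZero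

/-- Registered form (`stub_coreLevelZero`, level `c = 0` of the core stub
`stub_permanentalGradientPsdRank`): the all-variable family `Q_n = per[x^{(n)}] = n! · x₁ ⋯ xₙ`
(`r = 0`, `Y = 0 ≥ 0`) has `Q_n(𝟙) = n! > 0`, and at `n = 3` the gradient slack matrix on the cone
points `e_a`, `𝟙 - e_b` is `6 · I₃`, which admits no psd factorisation of size
`m ≤ 2 = 2^((log₂ 3 + 0)^0)` (triangular bound). [folklore] -/
theorem stub_coreLevelZero : ∃ (r : ℕ → ℕ) (Y : ∀ n : ℕ, Matrix (Fin n) (Fin n) ℝ), (∀ n i j, 0 ≤ Y n i j) ∧ ∀ P : ∀ n : ℕ, MvPolynomial (Fin n) ℝ, (∀ n, P n = (Matrix.of fun i j : Fin n => if (i : ℕ) < r n then MvPolynomial.C (Y n i j) else MvPolynomial.X j).permanent) → (∀ n : ℕ, 0 < MvPolynomial.eval (fun _ => (1 : ℝ)) (P n)) ∧ ∃ n : ℕ, ∀ m ≤ 2 ^ ((Nat.log 2 n + 0) ^ 0), ∃ (ι κ : Type) (xs : ι → Fin n → ℝ) (zs : κ → Fin n → ℝ), (∀ i, xs i ∈ hyperbolicityCone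 (P n) (fun _ => (1 : ℝ))) ∧ (∀ k, zs k ∈ hyperbolicityCone (P n) (fun _ => (1 : ℝ))) ∧ ¬ ∃ (U : ι → Matrix (Fin m) (Fin m) ℝ) (V : κ → Matrix (Fin m) (Fin m) ℝ), (∀ i, (U i).PosSemidef) ∧ (∀ k, (V k).PosSemidef) ∧ ∀ i k, gradForm (P n) (zs k) (xs i) = Matrix.trace (U i * V k) := by
  refine ⟨fun _ => 0, fun _ => 0, fun n i j => le_rfl, fun P hP => ?_⟩
  -- the family is `P n = n! · x₁ ⋯ xₙ`
  have hPn : ∀ n, P n =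
      C ((Nat.factorial n : ℕ) : ℝ) * ∏ i : Fin n, (X i : MvPolynomial (Fin n) ℝ) := fun n => by
    rw [hP n]
    exact LevelZero.rowPermanent_eq n 0
  have hfac : ∀ n, (0 : ℝ) < ((Nat.factorial n : ℕ) : ℝ) := fun n =>
    Nat.cast_pos.mpr (Nat.factorial_pos n)
  refine ⟨fun n => ?_, 3, fun m hm => ?_⟩
  · -- `Q_n(𝟙) = n! > 0`
    rw [hPn n, LevelZero.eval_C_mul_prod_X, Finset.prod_const_one, mul_one]
    exact hfac n
  · -- level `c = 0`: `m ≤ 2 ^ ((log₂ 3 + 0) ^ 0) = 2 < 3`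
    have hm2 : m ≤ 2 := by simpa using hm
    -- the cone points: basis vectors `e_a` and the points `𝟙 - e_b`, all entrywise `≥ 0`
    have hxs : ∀ a j : Fin 3, (0 : ℝ) ≤ (Pi.single a (1 : ℝ) : Fin 3 → ℝ) j := fun a j => by
      rcases eq_or_ne j a with rfl | h
      · rw [Pi.single_eq_same]
        exact zero_le_one
      · rw [Pi.single_eq_of_ne h]
    have hzs : ∀ b j : Fin 3, (0 : ℝ) ≤ (if j = b then (0 : ℝ) else 1) := fun b j => by
      split_ifs
      · exact le_rfl
      · exact zero_le_one
    -- the slack matrix is `3! · I₃`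
    have hM : ∀ a b : Fin 3,
        gradForm (P 3) (fun j => if j = b then 0 else 1) (Pi.single a 1) =
          if a = b then ((Nat.factorial 3 : ℕ) : ℝ) else 0 := fun a b => by
      rw [hPn 3]
      exact LevelZero.gradForm_C_mul_prod_X_single_indicator _ a b
    refine ⟨Fin 3, Fin 3, fun a => Pi.single a 1, fun b j => if j = b then 0 else 1,
      fun a => ?_, fun b => ?_, ?_⟩
    · show (Pi.single a (1 : ℝ) : Fin 3 → ℝ) ∈ hyperbolicityCone (P 3) (fun _ => (1 : ℝ))
      rw [hPn 3]
      exact LevelZero.mem_hyperbolicityCone_C_mul_prod_X (hfac 3) (hxs a)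
    · show (fun j => if j = b then (0 : ℝ) else 1) ∈ hyperbolicityCone (P 3) (fun _ => (1 : ℝ))
      rw [hPn 3]
      exact LevelZero.mem_hyperbolicityCone_C_mul_prod_X (hfac 3) (hzs b)
    · -- triangular (here: diagonal) pattern of size `3 > m`
      refine stub_psdRankTriangularBound (Fin 3) (Fin 3) m 3
        (fun a b => gradForm (P 3) (fun j => if j = b then 0 else 1) (Pi.single a 1)) id id
        (fun a => ?_) (fun a b hab => ?_) (by omega)
      · show gradForm (P 3) (fun j => if j = a then 0 else 1) (Pi.single a 1) ≠ 0
        rw [hM, if_pos rfl]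
        exact (hfac 3).ne'
      · show gradForm (P 3) (fun j => if j = b then 0 else 1) (Pi.single a 1) = 0
        rw [hM, if_neg (ne_of_lt hab)]

end Summit.ValiantsHypothesis.ValiantsHypothesis.Theorems.PermanentalConesPermanentalConeHard

end
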